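import Mathlib
import Summits.Ventures.PercRepro2.TypedDomainInstanceH2
import Summits.Ventures.PercRepro2.TypedBundleSepTwo

/-!
# p3 g7's (HARRIS-2) instance, II: it lies in the sixteen-condition domain (blind cell PercRepro2,
p2 g7, 2026-08-26; the lead's RULING 1 of 00:44:30Z — «hand-checked, the lead / p2 to confirm in
Lean»)

On `endsH2` (TypedDomainInstanceH2.lean) the four separator conditions of the domain of record
hold — the path `o–u–a₂` meets no door pair of (SEP-3) nor of the `{a₃, b}`-pocket, the path
`o–y–a₁` no door pair of the (SEP-3) mirror, the path `o–u–b` no door pair of (SEP-2) — so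
**`instanceH2_mem`**: the instance satisfies all sixteen conditions of
`ResidualCoreNHatCTBRASUDO7SP2`; the announced b-pocket class on the doors `{o, a₂}` meets the
sixteen-condition domain of record and its class theorem subtracts a non-empty part of it.  Own
code; standard axioms.
-/

namespace Summit.Ventures.PercRepro2

open UnionCluster

namespace CovForm

namespace TypedRed

namespace NonVacuityH2

open Separated (zF)
open NonVacuity (ends_mem_of_within)

/-! ## The separator classes: the path `o–u–a₂` meets no door pair of (SEP-3) nor of the
`{a₃, b}`-pocket, the path `o–y–a₁` none of the (SEP-3) mirror, the path `o–u–b` none of (SEP-2) -/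

/-- No separator `{a₁, a₃}` between `o` and `{a₂, b}`: the edge `o–u` puts `u` on `o`'s side, and
`u–a₂` would put `a₂` or `u` on both sides. -/
theorem noSepThreeH2 : ¬ SepThree.HasSepThree endsH2 0 1 2 3 4 FH2 := by
  rintro ⟨WO, WB, hs⟩
  have hoB : (0 : Fin 9) ∉ WB := fun h => by
    rcases hs.cap 0 hs.oO h with h1 | h3
    · exact absurd h1 (by decide)
    · exact absurd h3 (by decide)
  have e3 := hs.split 3 (zFH2 3)
  have huO : (5 : Fin 9) ∈ WO := by
    rcases e3 with w | w
    · exact (ends_mem_of_within (x := 5) (y := 0) rfl w).1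
    · exact absurd (ends_mem_of_within (x := 5) (y := 0) rfl w).2 hoB
  have e4 := hs.split 4 (zFH2 4)
  rcases e4 with w | w
  · have h2O := (ends_mem_of_within (x := 5) (y := 2) rfl w).2
    rcases hs.cap 2 h2O hs.a2B with h | h <;> exact absurd h (by decide)
  · have huB := (ends_mem_of_within (x := 5) (y := 2) rfl w).1
    rcases hs.cap 5 huO huB with h | h <;> exact absurd h (by decide)

/-- No separator `{a₂, a₃}` between `o` and `{a₁, b}` (the mirror): the edge `o–y` puts `y` on
`o`'s side, and `y–a₁` would put `a₁` or `y` on both sides. -/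
theorem noSepThreeMirrorH2 : ¬ SepThree.HasSepThree endsH2 0 2 1 3 4 FH2 := by
  rintro ⟨WO, WB, hs⟩
  have hoB : (0 : Fin 9) ∉ WB := fun h => by
    rcases hs.cap 0 hs.oO h with h1 | h3
    · exact absurd h1 (by decide)
    · exact absurd h3 (by decide)
  have e7 := hs.split 7 (zFH2 7)
  have hyO : (7 : Fin 9) ∈ WO := by
    rcases e7 with w | w
    · exact (ends_mem_of_within (x := 7) (y := 0) rfl w).1
    · exact absurd (ends_mem_of_within (x := 7) (y := 0) rfl w).2 hoB
  have e9 := hs.split 9 (zFH2 9)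
  rcases e9 with w | w
  · have h1O := (ends_mem_of_within (x := 7) (y := 1) rfl w).2
    rcases hs.cap 1 h1O hs.a2B with h | h <;> exact absurd h (by decide)
  · have hyB := (ends_mem_of_within (x := 7) (y := 1) rfl w).1
    rcases hs.cap 7 hyO hyB with h | h <;> exact absurd h (by decide)

/-- No `{a₃, b}`-pocket: `o–u` puts `u` on `o`'s side, `u–a₂` on the roots' side. -/
theorem noPocketH2 : ¬ PocketAB.HasPocketAB endsH2 0 1 2 3 4 FH2 := by
  rintro ⟨WO, WB, hs⟩
  have hoB : (0 : Fin 9) ∉ WB := fun h => by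
    rcases hs.cap 0 hs.oO h with h3 | hb
    · exact absurd h3 (by decide)
    · exact absurd hb (by decide)
  have h2O : (2 : Fin 9) ∉ WO := fun h => by
    rcases hs.cap 2 h hs.a2B with h3 | hb
    · exact absurd h3 (by decide)
    · exact absurd hb (by decide)
  have huO : (5 : Fin 9) ∈ WO := by
    rcases hs.split 3 (zFH2 3) with w | w
    · exact (ends_mem_of_within (x := 5) (y := 0) rfl w).1
    · exact absurd (ends_mem_of_within (x := 5) (y := 0) rfl w).2 hoB
  have huB : (5 : Fin 9) ∈ WB := by
    rcases hs.split 4 (zFH2 4) with w | w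
    · exact absurd (ends_mem_of_within (x := 5) (y := 2) rfl w).2 h2O
    · exact (ends_mem_of_within (x := 5) (y := 2) rfl w).1
  rcases hs.cap 5 huO huB with h | h <;> exact absurd h (by decide)

/-- No (SEP-2) split with `a₃` on `b`'s side: `o–u` puts `u` on `o`'s side, `u–b` on `b`'s. -/
theorem noSepTwoBH2 : ¬ SepTwo.HasSepTwoB endsH2 0 1 2 3 4 FH2 := by
  rintro ⟨WO, WB, hs⟩
  have hoB : (0 : Fin 9) ∉ WB := fun h => by
    rcases hs.cap 0 hs.oO h with h1 | h2
    · exact absurd h1 (by decide)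
    · exact absurd h2 (by decide)
  have hbO : (4 : Fin 9) ∉ WO := fun h => by
    rcases hs.cap 4 h hs.bB with h1 | h2
    · exact absurd h1 (by decide)
    · exact absurd h2 (by decide)
  have huO : (5 : Fin 9) ∈ WO := by
    rcases hs.split 3 (zFH2 3) with w | w
    · exact (ends_mem_of_within (x := 5) (y := 0) rfl w).1
    · exact absurd (ends_mem_of_within (x := 5) (y := 0) rfl w).2 hoB
  have huB : (5 : Fin 9) ∈ WB := by
    rcases hs.split 0 (zFH2 0) with w | w
    · exact absurd (ends_mem_of_within (x := 4) (y := 5) rfl w).1 hbO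
    · exact (ends_mem_of_within (x := 4) (y := 5) rfl w).2
  rcases hs.cap 5 huO huB with h | h <;> exact absurd h (by decide)

/-- No (SEP-2) split with `a₃` on `o`'s side: the same two edges. -/
theorem noSepTwoOH2 : ¬ SepTwo.HasSepTwoO endsH2 0 1 2 3 4 FH2 := by
  rintro ⟨WO, WB, hs⟩
  have hoB : (0 : Fin 9) ∉ WB := fun h => by
    rcases hs.cap 0 hs.oO h with h1 | h2
    · exact absurd h1 (by decide)
    · exact absurd h2 (by decide)
  have hbO : (4 : Fin 9) ∉ WO := fun h => by
    rcases hs.cap 4 h hs.bB with h1 | h2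
    · exact absurd h1 (by decide)
    · exact absurd h2 (by decide)
  have huO : (5 : Fin 9) ∈ WO := by
    rcases hs.split 3 (zFH2 3) with w | w
    · exact (ends_mem_of_within (x := 5) (y := 0) rfl w).1
    · exact absurd (ends_mem_of_within (x := 5) (y := 0) rfl w).2 hoB
  have huB : (5 : Fin 9) ∈ WB := by
    rcases hs.split 0 (zFH2 0) with w | w
    · exact absurd (ends_mem_of_within (x := 4) (y := 5) rfl w).1 hbO
    · exact (ends_mem_of_within (x := 4) (y := 5) rfl w).2
  rcases hs.cap 5 huO huB with h | h <;> exact absurd h (by decide)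

/-- No (SEP-2) separator at all. -/
theorem noSepTwoH2 : ¬ SepTwo.HasSepTwo endsH2 0 1 2 3 4 FH2 := fun h =>
  h.elim noSepTwoBH2 noSepTwoOH2

/-! ## The assembly -/

/-- The fourteen conditions. -/
theorem instanceH2_mem14 : ResidualCoreNHatCTBRASUDO7S endsH2 0 1 2 3 4 FH2 :=
  ⟨instanceH2_mem12, noSepThreeH2, noSepThreeMirrorH2⟩

/-- The fifteen conditions. -/
theorem instanceH2_mem15 : ResidualCoreNHatCTBRASUDO7SP endsH2 0 1 2 3 4 FH2 :=
  ⟨instanceH2_mem14, noPocketH2⟩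

/-- **p3 g7's (HARRIS-2) instance lies in the sixteen-condition domain of record**: the b-pocket
class on the doors `{o, a₂}` meets `ResidualCoreNHatCTBRASUDO7SP2`. -/
theorem instanceH2_mem : ResidualCoreNHatCTBRASUDO7SP2 endsH2 0 1 2 3 4 FH2 :=
  ⟨instanceH2_mem15, noSepTwoH2⟩

end NonVacuityH2

end TypedRed

end CovForm

end Summit.Ventures.PercRepro2
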